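/-
Copyright (c) 2026 the pub-hodgecm-mathlib formalisation cell (harness21).  Prover seat hodgecm-mathlib-K2Liu-p14 (g3), Track B «K2-LIT»,
#184♮ = hLiu418 = `stmt-HodgeConjecture-24832`; Road I v3, S5-F3 lineage ∕ I4-conv (F′-fact): the `hK` letter of FILE C — right-`U(J₂)(𝒪_v)`-invariance of `J_v`.
-/
import Summits.HodgeConjecture.HodgeConjecture.Theorems.K2LiuKlingenInnerSectionLocalDefs   -- ★ FILE B: `innerSectionLoc`, `klingenLeviLoc`, `jLoc`, `coe_jLoc_apply`
import Summits.HodgeConjecture.HodgeConjecture.Theorems.K2LiuKlingenLeviDecomposition       -- ★ `klingenLevi_inv` (+ ★ `klingenLevi_mul`, `coe_klingenLevi`)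
import Literature.NumberTheory.K2Lit.LocalDoublingSiegel                                    -- ★ D7c: `LambdaLoc`, `lambdaLoc_mul_localInt`
import HarnessLib

/-!
# Crux `HLiu418`, I4-conv (F′-fact) — `K2LiuKlingenInnerSectionLocalInvariance`: THE `hK` LETTER OF ★ FILE C `K2LiuKlingenInnerSectionSpherical` FOR THE
# LOCAL INNER FUNCTIONAL `J_v = innerSectionLoc v …` OF ★ FILE B — `J_v(g k) = J_v(g)` for `k ∈ U(J₂)(𝒪_v)`

Cell `hodgecm-mathlib`, crux item hLiu418 = `stmt-HodgeConjecture-24832`; squad K2 ∕ K2Liu; LEAD F0P6-plan (g14) BATCH #36; prover K2Liu-p14 (g3).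
THEOREMS ONLY (no `def`, no instance, no notation, no named-fact hypothesis, no `sorry`); lane `--supports stmt-HodgeConjecture-24832 --as helper` (count-neutral).

★ FILE C (F0P2-p10, `K2LiuKlingenInnerSectionSpherical.apply_eq_apply_one_mul_lambdaLoc_apply`) turns a local functional `Jv : U(J₂)(L⁺_v) → ℂ` with the local Borel
law (`hlaw`) and right-`U(J₂)(𝒪_v)`-invariance (`hK : ∀ k ∈ localInt … 2 J v, ∀ g, Jv (g * k) = Jv g`) into `Jv(1) · Λ^{line}_{σ,v} ∘ Ψ_{S,v}`.  This file PAYS `hK`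
for the functional of record `Jv := innerSectionLoc v νY νT Ψ_v f_v x_v` (★ FILE B: `∫ f_v(Ψ_v(ξ_v n_{Q,v}(q) m_{Q,v}(1,y_v)) x_v) dq`) from three by-value letters
that the factorisation frame supplies at every good place: `hΨK` (`Ψ_v` carries `U(J₄)(𝒪_v)` into `K_{H,v}` — for the F-files' `Ψ`, `Ψ_v = psiLoc Ψ v` and this is the
integrality of the pinned matrix `S_𝔸` at `v`), `hfK` (`f_v` is right-`K_{H,v}`-invariant — ★ `lambdaLoc_mul_localInt` for `f_v = Λ_{s,v}`) and `hx` (`x_v = h_v ∈ K_{H,v}`).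
* §1 `klingenLeviLoc_one_mul` (`m_{Q,v}(1, g k) = m_{Q,v}(1,g) m_{Q,v}(1,k)`), `klingenLeviLoc_one_inv`, generic `klingenLeviM_one_apply_mem` (entries of `m_Q(1,g)` lie in
  any subring containing the entries of `g`), **`klingenLeviLoc_one_mem_localInt`** (`k ∈ U(J₂)(𝒪_v) ⇒ m_{Q,v}(1,k) ∈ U(J₄)(𝒪_v)`, ★ `mem_localInt_iff`, ★ `mem_glInt_iff`).
* §2 **`innerSectionLoc_mul_localInt`** — THE `hK` LETTER: `J_v(g k) = J_v(g)` (the integrands agree pointwise: `Ψ_v(m_{Q,v}(1,k)) x_v = x_v · (x_v⁻¹ Ψ_v(m_{Q,v}(1,k)) x_v)`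
  with the bracket in `K_{H,v}`); `innerSectionLoc_lambdaLoc_mul_localInt` — the instance `f_v = Λ_{s,v}` (`hfK` discharged by ★ `lambdaLoc_mul_localInt`).
[MoeglinWaldspurger1995, II.1.7], [PlatonovRapinchuk1994, §5.1], [BorelJacquet1979, §4.1], [Li1992, §3].
HONEST LABEL.  Count-neutral helper, closes no socket: `HC_CM` is proved only modulo the 7 printed citations (2 remaining named inputs: hLiu418 =
`stmt-HodgeConjecture-24832`, h413 = `stmt-HodgeConjecture-24833`) until rung 0 closes.
-/

set_option autoImplicit false
set_option linter.dupNamespace false -- the mandated namespace repeats `HodgeConjecture.HodgeConjecture`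

noncomputable section

open scoped Matrix
open NumberField IsDedekindDomain MeasureTheory

namespace Summit.HodgeConjecture.HodgeConjecture.Cruxes.HLiu418.K2LiuKlingenInnerSectionLocalInvariance

open Literature.NumberTheory.Automorphic Literature.NumberTheory.Automorphic.UnitaryGroup
open Literature.NumberTheory.GelbartRogawski1991 Literature.NumberTheory.GelbartRogawski1991.GRConstruction
open Literature.NumberTheory.GaloisRepresentations
open Literature.NumberTheory.K2Lit.SiegelDoubled
open Summit.HodgeConjecture.HodgeConjecture.Cruxes.HLiu418.K2LiuKlingenParabolicDefs
open Summit.HodgeConjecture.HodgeConjecture.Cruxes.HLiu418.K2LiuKlingenLeviDecomposition (klingenLevi_inv)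
open Summit.HodgeConjecture.HodgeConjecture.Cruxes.HLiu418.K2LiuKlingenInnerSectionLocalDefs

variable (L : Type) [Field L] [NumberField L] [IsCMField L]

/-! ## §1 `m_{Q,v}(1, ·)` is a homomorphism `U(J₂)(L⁺_v) → U(J₄)(L⁺_v)` carrying `U(J₂)(𝒪_v)` into `U(J₄)(𝒪_v)` -/

set_option maxHeartbeats 400000 in -- MEASURED: generic-ring ★ `klingenLevi_mul` instantiated at `LocalRing L v` (instance-path unification, as ★ FILE B)
/-- **`m_{Q,v}(1, g k) = m_{Q,v}(1, g) · m_{Q,v}(1, k)`** (★ `klingenLevi_mul` through the multiplicative `j_v`). [cite: MoeglinWaldspurger1995, II.1.7] -/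
theorem klingenLeviLoc_one_mul (v : HeightOneSpectrum (𝓞 (Fp L)))
    (g k : UnitaryGroup.localPi L (IsCMField.complexConj L) 2 ((StdForm.antidiagonal 2).over L) v) :
    klingenLeviLoc L v 1 (g * k) = klingenLeviLoc L v 1 g * klingenLeviLoc L v 1 k := by
  have hmul := klingenLevi_mul (R := LocalRing L v) (σ := conjLocal L (IsCMField.complexConj L) v) (conjLocal_conjLocal_cm L v) 1 1
    ((jLoc L 2 v).symm g) ((jLoc L 2 v).symm k)
  rw [mul_one] at hmul
  rw [klingenLeviLoc, klingenLeviLoc, klingenLeviLoc, ← map_mul (jLoc L 4 v), map_mul (jLoc L 2 v).symm, hmul]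

set_option maxHeartbeats 400000 in -- MEASURED: as `klingenLeviLoc_one_mul`
/-- **`m_{Q,v}(1, k)⁻¹ = m_{Q,v}(1, k⁻¹)`** (★ `klingenLevi_inv`). [cite: MoeglinWaldspurger1995, I.2.1] -/
theorem klingenLeviLoc_one_inv (v : HeightOneSpectrum (𝓞 (Fp L)))
    (k : UnitaryGroup.localPi L (IsCMField.complexConj L) 2 ((StdForm.antidiagonal 2).over L) v) :
    (klingenLeviLoc L v 1 k)⁻¹ = klingenLeviLoc L v 1 k⁻¹ := by
  have hinv := klingenLevi_inv (R := LocalRing L v) (σ := conjLocal L (IsCMField.complexConj L) v) (conjLocal_conjLocal_cm L v) 1 ((jLoc L 2 v).symm k)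
  rw [inv_one] at hinv
  rw [klingenLeviLoc, klingenLeviLoc, ← map_inv (jLoc L 4 v), hinv, map_inv (jLoc L 2 v).symm]

omit [IsCMField L] in
/-- the entries of `m_Q(1, g)` (`1`, `0`, the entries of `g`, `σ(1⁻¹) = 1`) lie in every subring containing the entries of `g`. [cite: Xiong2013, §7 Lemma 7.1] -/
theorem klingenLeviM_one_apply_mem {R : Type*} [CommRing R] (σ : R →+* R) (S : Subring R) (g : unitaryGroupOfForm σ ((StdForm.antidiagonal 2).over R))
    (hg : ∀ a b, (g : GL (Fin 2) R).val a b ∈ S) (i j : Fin 4) : klingenLeviM R σ 1 g i j ∈ S := by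
  fin_cases i <;> fin_cases j <;> simp [klingenLeviM, hg, S.one_mem, S.zero_mem]

set_option maxHeartbeats 400000 in -- MEASURED: instance-path unification `Pi.commRing (LocalRing L v)` vs the generic `[CommRing R]` of `klingenLeviM_one_apply_mem` (as ★ FILE B)
/-- **`k ∈ U(J₂)(𝒪_v) ⇒ m_{Q,v}(1, k) ∈ U(J₄)(𝒪_v)`**: every `w`-block of `m_{Q,v}(1,k)` and of its inverse `m_{Q,v}(1,k⁻¹)` has integral entries (★ `mem_localInt_iff`,
★ `mem_glInt_iff`, §1). [cite: PlatonovRapinchuk1994, §5.1] -/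
theorem klingenLeviLoc_one_mem_localInt (v : HeightOneSpectrum (𝓞 (Fp L)))
    {k : UnitaryGroup.localPi L (IsCMField.complexConj L) 2 ((StdForm.antidiagonal 2).over L) v}
    (hk : k ∈ UnitaryGroup.localInt L (IsCMField.complexConj L) 2 ((StdForm.antidiagonal 2).over L) v) :
    klingenLeviLoc L v 1 k ∈ UnitaryGroup.localInt L (IsCMField.complexConj L) 4 ((StdForm.antidiagonal 4).over L) v := by
  have hk' : k⁻¹ ∈ UnitaryGroup.localInt L (IsCMField.complexConj L) 2 ((StdForm.antidiagonal 2).over L) v := inv_mem hk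
  rw [UnitaryGroup.mem_localInt_iff] at hk hk' ⊢
  intro w
  have hkw := (mem_glInt_iff _).1 (hk w)
  have hkw' := (mem_glInt_iff _).1 (hk' w)
  -- the entries of `k` and of `k⁻¹`, read in `L_v`, lie in the pull-back of `𝒪_w`
  have hent : ∀ a b, ((((jLoc L 2 v).symm k : unitaryGroupOfForm (conjLocal L (IsCMField.complexConj L) v) ((StdForm.antidiagonal 2).over (LocalRing L v))) :
      GL (Fin 2) (LocalRing L v)).val a b) ∈ (ValuativeRel.valuation (w.1.adicCompletion L)).integer.comap (Pi.evalRingHom (fun w : UnitaryGroup.PlacesOver L v => w.1.adicCompletion L) w) :=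
    fun a b => by rw [Subring.mem_comap, Pi.evalRingHom_apply, coe_jLoc_symm_apply]; exact hkw.1 a b
  have hent' : ∀ a b, ((((jLoc L 2 v).symm k⁻¹ : unitaryGroupOfForm (conjLocal L (IsCMField.complexConj L) v) ((StdForm.antidiagonal 2).over (LocalRing L v))) :
      GL (Fin 2) (LocalRing L v)).val a b) ∈ (ValuativeRel.valuation (w.1.adicCompletion L)).integer.comap (Pi.evalRingHom (fun w : UnitaryGroup.PlacesOver L v => w.1.adicCompletion L) w) :=
    fun a b => by rw [Subring.mem_comap, Pi.evalRingHom_apply, coe_jLoc_symm_apply]; exact hkw'.1 a b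
  refine (mem_glInt_iff _).2 ⟨fun i j => ?_, fun i j => ?_⟩
  · have h := klingenLeviM_one_apply_mem (R := LocalRing L v) (conjLocal L (IsCMField.complexConj L) v) _ _ hent i j
    rw [Subring.mem_comap, Pi.evalRingHom_apply] at h
    rw [klingenLeviLoc, coe_jLoc_apply, coe_klingenLevi]
    exact h
  · have h := klingenLeviM_one_apply_mem (R := LocalRing L v) (conjLocal L (IsCMField.complexConj L) v) _ _ hent' i j
    rw [Subring.mem_comap, Pi.evalRingHom_apply] at h
    rw [← Pi.inv_apply, ← Subgroup.coe_inv, klingenLeviLoc_one_inv, klingenLeviLoc, coe_jLoc_apply, coe_klingenLevi]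
    exact h

/-! ## §2 The `hK` letter: `J_v(g k) = J_v(g)` for `k ∈ U(J₂)(𝒪_v)` -/

/-- **THE `hK` LETTER OF ★ FILE C FOR `J_v = innerSectionLoc v νY νT Ψ_v f_v x_v`.**  If `Ψ_v` carries `U(J₄)(𝒪_v)` into `K_{H,v}` (`hΨK`), `f_v` is
right-`K_{H,v}`-invariant (`hfK`) and `x_v ∈ K_{H,v}` (`hx`), then `J_v(g k) = J_v(g)` for every `k ∈ U(J₂)(𝒪_v)` and every `g` — the integrands agree pointwise:
`f_v(Ψ_v(ξ n(q) m(1,g) m(1,k)) x_v) = f_v((Ψ_v(ξ n(q) m(1,g)) x_v) · (x_v⁻¹ Ψ_v(m(1,k)) x_v))` and the bracket lies in `K_{H,v}` (§1). [cite: MoeglinWaldspurger1995, II.1.7] [cite: BorelJacquet1979, §4.1] -/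
theorem innerSectionLoc_mul_localInt (v : HeightOneSpectrum (𝓞 (Fp L))) [MeasurableSpace ↥(skewLoc L v)] [MeasurableSpace (LocalRing L v)]
    (νY : Measure ↥(skewLoc L v)) (νT : Measure (LocalRing L v)) {N' : ℕ} {J' : Matrix (Fin N') (Fin N') L}
    (Ψv : UnitaryGroup.localPi L (IsCMField.complexConj L) 4 ((StdForm.antidiagonal 4).over L) v →* UnitaryGroup.localPi L (IsCMField.complexConj L) N' J' v)
    (hΨK : ∀ k ∈ UnitaryGroup.localInt L (IsCMField.complexConj L) 4 ((StdForm.antidiagonal 4).over L) v, Ψv k ∈ UnitaryGroup.localInt L (IsCMField.complexConj L) N' J' v)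
    (fv : UnitaryGroup.localPi L (IsCMField.complexConj L) N' J' v → ℂ)
    (hfK : ∀ k ∈ UnitaryGroup.localInt L (IsCMField.complexConj L) N' J' v, ∀ g : UnitaryGroup.localPi L (IsCMField.complexConj L) N' J' v, fv (g * k) = fv g)
    {xv : UnitaryGroup.localPi L (IsCMField.complexConj L) N' J' v} (hx : xv ∈ UnitaryGroup.localInt L (IsCMField.complexConj L) N' J' v)
    (k : UnitaryGroup.localPi L (IsCMField.complexConj L) 2 ((StdForm.antidiagonal 2).over L) v)
    (hk : k ∈ UnitaryGroup.localInt L (IsCMField.complexConj L) 2 ((StdForm.antidiagonal 2).over L) v)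
    (g : UnitaryGroup.localPi L (IsCMField.complexConj L) 2 ((StdForm.antidiagonal 2).over L) v) :
    innerSectionLoc L v νY νT Ψv fv xv (g * k) = innerSectionLoc L v νY νT Ψv fv xv g := by
  have hkk : xv⁻¹ * Ψv (klingenLeviLoc L v 1 k) * xv ∈ UnitaryGroup.localInt L (IsCMField.complexConj L) N' J' v :=
    mul_mem (mul_mem (inv_mem hx) (hΨK _ (klingenLeviLoc_one_mem_localInt L v hk))) hx
  have hpt : ∀ q : ↥(skewLoc L v) × LocalRing L v,
      fv (Ψv (weylXiLoc L v * nKlingenLoc L v (q.1 : LocalRing L v) q.1.2 0 q.2 * klingenLeviLoc L v 1 (g * k)) * xv) =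
        fv (Ψv (weylXiLoc L v * nKlingenLoc L v (q.1 : LocalRing L v) q.1.2 0 q.2 * klingenLeviLoc L v 1 g) * xv) := by
    intro q
    have heq : Ψv (weylXiLoc L v * nKlingenLoc L v (q.1 : LocalRing L v) q.1.2 0 q.2 * klingenLeviLoc L v 1 (g * k)) * xv =
        Ψv (weylXiLoc L v * nKlingenLoc L v (q.1 : LocalRing L v) q.1.2 0 q.2 * klingenLeviLoc L v 1 g) * xv * (xv⁻¹ * Ψv (klingenLeviLoc L v 1 k) * xv) := by
      rw [klingenLeviLoc_one_mul, ← mul_assoc (weylXiLoc L v * _), map_mul]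
      group
    rw [heq, hfK _ hkk]
  simp only [innerSectionLoc_def, hpt]

/-- **THE INSTANCE OF RECORD: `f_v = Λ_{s,v}`** (★ `LambdaLoc` of the doubled group `H = U(𝕍 ⊕ −𝕍)`, `χ` unramified above `v`; `hfK` discharged by ★ `lambdaLoc_mul_localInt`):
`J_v(g k) = J_v(g)` for `k ∈ U(J₂)(𝒪_v)`, given `hΨK` and `h_v ∈ K_{H,v}` — the `hK` binder of ★ `K2LiuKlingenInnerSectionSpherical.apply_eq_apply_one_mul_lambdaLoc_apply` VERBATIM for
`Jv := innerSectionLoc v νY νT Ψ_v (LambdaLoc … v χ s) h_v`. [cite: Li1992, §3] [cite: MoeglinWaldspurger1995, II.1.7] -/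
theorem innerSectionLoc_lambdaLoc_mul_localInt (v : HeightOneSpectrum (𝓞 (Fp L))) [MeasurableSpace ↥(skewLoc L v)] [MeasurableSpace (LocalRing L v)]
    (νY : Measure ↥(skewLoc L v)) (νT : Measure (LocalRing L v))
    {N M n : ℕ} (e : Fin N × Fin M ≃ Fin n) (dV : Fin N → L) (hdV : ∀ i, IsCMField.complexConj L (dV i) = dV i)
    (dW : Fin M → L) (hdW : ∀ i, IsCMField.complexConj L (dW i) = dW i)
    (Ψv : UnitaryGroup.localPi L (IsCMField.complexConj L) 4 ((StdForm.antidiagonal 4).over L) v →*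
      UnitaryGroup.localPi L (IsCMField.complexConj L) (n + n) (hermD L e dV hdV dW hdW) v)
    (hΨK : ∀ k ∈ UnitaryGroup.localInt L (IsCMField.complexConj L) 4 ((StdForm.antidiagonal 4).over L) v,
      Ψv k ∈ UnitaryGroup.localInt L (IsCMField.complexConj L) (n + n) (hermD L e dV hdV dW hdW) v)
    (χ : HeckeCharacter L) (s : ℂ) (hχ : ∀ w : UnitaryGroup.PlacesOver L v, χ.IsUnramifiedAt w.1)
    {hv : UnitaryGroup.localPi L (IsCMField.complexConj L) (n + n) (hermD L e dV hdV dW hdW) v}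
    (hh : hv ∈ UnitaryGroup.localInt L (IsCMField.complexConj L) (n + n) (hermD L e dV hdV dW hdW) v) :
    ∀ k ∈ UnitaryGroup.localInt L (IsCMField.complexConj L) 2 ((StdForm.antidiagonal 2).over L) v,
      ∀ g : UnitaryGroup.localPi L (IsCMField.complexConj L) 2 ((StdForm.antidiagonal 2).over L) v,
        innerSectionLoc L v νY νT Ψv (LambdaLoc L e dV hdV dW hdW v χ s) hv (g * k) = innerSectionLoc L v νY νT Ψv (LambdaLoc L e dV hdV dW hdW v χ s) hv g :=
  fun k hk g => innerSectionLoc_mul_localInt L v νY νT Ψv hΨK _ (fun _ hk' g' => lambdaLoc_mul_localInt L e dV hdV dW hdW v χ s hχ g' hk') hh k hk g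

end Summit.HodgeConjecture.HodgeConjecture.Cruxes.HLiu418.K2LiuKlingenInnerSectionLocalInvariance

end
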